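import Summits.AtomisticToContinuum.Crystallization.Theorems.ThreeConeCertificateExactCertificateSlacknessBlocks

/-!
# `ExactCertificate` (stmt-AtomisticToContinuum-11959), line `closure-makes-nogap-exact`:
# complementary slackness of a witness, II — periodic energies of the three cones

Continuation of `…SlacknessBlocks`.  For a split `IsSplit ρ c g U f` with
`c + f 0 / 2 ≤ −e(P)`:

* block energies of a finite-range potential `W` (`W = 0` on `[ρ,∞)`) converge to its energy per
  particle: `|2E_W(block_K) − K³·2#F·e_W(P)| ≤ C·K²` (`abs_two_mul_energy_block_sub_le`);
* **`e_g(P) = −c`** (`energyPerParticle_g_eq`): the witness configuration is an exact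
  per-particle ground state of the finite-range cone;
* **`e_U(P) = 0`** (`energyPerParticle_U_eq_zero`);
* the periodic energy splits, `e(P) = e_g(P) + e_U(P) + e_f(P)` (`energyPerParticle_split`), and
  hence **`f 0 + 2·e_f(P) = 0`** (`f_zero_add_two_mul_energyPerParticle_f`): the `P`-sum of `f`
  including the self-term vanishes.

All `[folklore]`; adapted from the crux workfile `Cruxes/ExactCertificate/Disproof.lean` §4
(refuter, cdisprove seat) against the importable `Theorems` API.
-/

noncomputable section

namespace Summit.AtomisticToContinuum.Crystallization.Theorems.ThreeConeCertificateExactCertificate.Slackness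

open Literature.MathematicalPhysics.StatisticalMechanics
open Summit.AtomisticToContinuum.Crystallization.Theses.ThreeConeCertificate
open Summit.AtomisticToContinuum.Crystallization.Theorems.ChargedEnergyGapNegative
  (E3 eStar eStar_le)
open Summit.AtomisticToContinuum.Crystallization.Theorems.ChargedEnergyGapNegative.Blocks
  (BIdx bpt bpt_injective blockConfig blockConfig_apply blockConfig_injective card_BIdx
    IsDeep card_not_deep_le siteSum siteSum_bpt sum_siteSum_eq blockOthers tail sum_blockOthers
    depth le_dist_of_deep)
open Summit.AtomisticToContinuum.Crystallization.Theorems.ExactCertificateNegative (IsSplit)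
open scoped BigOperators

/-! ## Block energies of finite-range potentials -/

section FiniteRange

variable (P : PeriodicConfiguration 3) {W : ℝ → ℝ} {ρ : ℝ}

/-- A finite-range site function on a periodic configuration is finitely supported. [folklore] -/
theorem finite_support_of_finRange (hW : ∀ r, ρ ≤ r → W r = 0) (p : E3) :
    (Function.support fun q : {q : E3 // q ∈ P.points ∧ q ≠ p} => W (dist p q.1)).Finite := by
  have hfin := P.finite_inter_points (Metric.isBounded_ball (x := p) (r := ρ))
  refine (hfin.preimage Subtype.val_injective.injOn).subset ?_
  intro q hq
  refine ⟨?_, q.2.1⟩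
  rw [Metric.mem_ball, dist_comm]
  by_contra hle
  exact hq (hW _ (not_lt.1 hle))

/-- Hence it is summable. [folklore] -/
theorem summable_of_finRange (hW : ∀ r, ρ ≤ r → W r = 0) (p : E3) :
    Summable fun q : {q : E3 // q ∈ P.points ∧ q ≠ p} => W (dist p q.1) :=
  summable_of_hasFiniteSupport (finite_support_of_finRange P hW p)

/-- Row identity in a block: `siteSum W (bpt u) = Σ_{v ≠ u in block} W(|u − v|) + tail W u`.
[folklore] -/
theorem siteSum_eq_row_add_tail (hW : ∀ r, ρ ≤ r → W r = 0) (K : ℕ) (u : BIdx P K) :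
    siteSum P W (bpt P K u) =
      ∑ v ∈ Finset.univ.erase u, W (dist (bpt P K u) (bpt P K v)) + tail P K W u := by
  unfold siteSum tail
  rw [← sum_blockOthers, (summable_of_finRange P hW (bpt P K u)).sum_add_tsum_compl]

/-- Deep block points have no tail for a finite-range potential. [folklore] -/
theorem tail_eq_zero_of_deep (hW : ∀ r, ρ ≤ r → W r = 0) {K : ℕ} {u : BIdx P K}
    (hdeep : IsDeep K (depth P ρ) u.2) : tail P K W u = 0 := by
  unfold tail
  have h : ∀ q : ((blockOthers P K u : Set {q : E3 // q ∈ P.points ∧ q ≠ bpt P K u})ᶜ : Set _),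
      W (dist (bpt P K u) q.1.1) = 0 := fun q =>
    hW _ (le_dist_of_deep P K hdeep q.1 (by
      have := q.2
      rwa [Set.mem_compl_iff, Finset.mem_coe] at this))
  simp only [h, tsum_zero]

/-- Every tail is bounded by the absolute site sum at the motif point. [folklore] -/
theorem abs_tail_le (hW : ∀ r, ρ ≤ r → W r = 0) {K : ℕ} (u : BIdx P K) :
    |tail P K W u| ≤ siteSum P (fun r => |W r|) u.1 := by
  rw [← siteSum_bpt P K (fun r => |W r|) u]
  have hsW : Summable fun q : {q : E3 // q ∈ P.points ∧ q ≠ bpt P K u} =>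
      W (dist (bpt P K u) q.1) := summable_of_finRange P hW _
  have hs : Summable fun q : {q : E3 // q ∈ P.points ∧ q ≠ bpt P K u} =>
      |W (dist (bpt P K u) q.1)| := hsW.abs
  have h1 : |tail P K W u| ≤
      ∑' q : (((blockOthers P K u : Set {q : E3 // q ∈ P.points ∧ q ≠ bpt P K u})ᶜ :
        Set {q : E3 // q ∈ P.points ∧ q ≠ bpt P K u})), |W (dist (bpt P K u) q.1.1)| := by
    have hsub := Summable.subtype (f := fun q : {q : E3 // q ∈ P.points ∧ q ≠ bpt P K u} =>
      |W (dist (bpt P K u) q.1)|) hs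
      ((blockOthers P K u : Set {q : E3 // q ∈ P.points ∧ q ≠ bpt P K u})ᶜ)
    exact norm_tsum_le_tsum_norm (E := ℝ)
      (f := fun q : (((blockOthers P K u : Set {q : E3 // q ∈ P.points ∧ q ≠ bpt P K u})ᶜ :
        Set {q : E3 // q ∈ P.points ∧ q ≠ bpt P K u})) => W (dist (bpt P K u) q.1.1)) hsub
  have h2 := Summable.tsum_subtype_le (γ := ℝ)
    (f := fun q : {q : E3 // q ∈ P.points ∧ q ≠ bpt P K u} => |W (dist (bpt P K u) q.1)|)
    (β := ((blockOthers P K u : Set {q : E3 // q ∈ P.points ∧ q ≠ bpt P K u})ᶜ))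
    (fun _ => abs_nonneg _) hs
  exact h1.trans h2

/-- The double sum over a block, re-indexed by block indices. [folklore] -/
theorem two_mul_energy_block (W : ℝ → ℝ) (K : ℕ) :
    2 * interactionEnergy W (blockConfig P K) =
      ∑ u : BIdx P K, ∑ v ∈ Finset.univ.erase u, W (dist (bpt P K u) (bpt P K v)) := by
  classical
  rw [two_mul_interactionEnergy]
  set e := Fintype.equivFin (BIdx P K) with he
  have hrow : ∀ u : BIdx P K, siteEnergy W (blockConfig P K) (e u) =
      ∑ v ∈ Finset.univ.erase u, W (dist (bpt P K u) (bpt P K v)) := by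
    intro u
    unfold siteEnergy
    rw [Finset.sum_erase_eq_sub (Finset.mem_univ _), Finset.sum_erase_eq_sub (Finset.mem_univ _)]
    simp only [blockConfig_apply, ← he, Equiv.symm_apply_apply]
    congr 1
    exact (e.symm.sum_comp (fun v => W (dist (bpt P K u) (bpt P K v))))
  rw [← e.symm.sum_comp]
  refine Finset.sum_congr rfl fun a _ => ?_
  have := hrow (e.symm a)
  rw [Equiv.apply_symm_apply] at this
  exact this

/-- **Block energy identity for a finite-range potential**:
`2E_W(block_K) = K³·2#F·e_W(P) − Σ_u tail_W(u)`. [folklore] -/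
theorem two_mul_energy_block_eq_sub_tails (hW : ∀ r, ρ ≤ r → W r = 0) (K : ℕ) :
    2 * interactionEnergy W (blockConfig P K) =
      (K : ℝ) ^ 3 * (2 * P.motif.card * P.energyPerParticle W) - ∑ u : BIdx P K, tail P K W u := by
  rw [two_mul_energy_block, Finset.sum_congr rfl fun u _ =>
    (eq_sub_of_add_eq (siteSum_eq_row_add_tail P hW K u).symm), Finset.sum_sub_distrib,
    ← sum_siteSum_eq, Fintype.sum_prod_type]
  simp only [siteSum_bpt, Finset.sum_const, Finset.card_univ, Fintype.card_fun, Fintype.card_fin,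
    nsmul_eq_mul]
  rw [← Finset.mul_sum, Finset.sum_coe_sort P.motif (siteSum P W)]
  push_cast
  ring

/-- The total tail is `O(K²)`: `|Σ_u tail u| ≤ 6ρ'K² · Σ_{x ∈ F} siteSum |W| x`. [folklore] -/
theorem abs_sum_tail_le (hW : ∀ r, ρ ≤ r → W r = 0) (K : ℕ) :
    |∑ u : BIdx P K, tail P K W u| ≤
      6 * depth P ρ * (K : ℝ) ^ 2 * ∑ x ∈ P.motif, siteSum P (fun r => |W r|) x := by
  classical
  have hsite0 : ∀ x, 0 ≤ siteSum P (fun r => |W r|) x := fun x => tsum_nonneg fun _ => abs_nonneg _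
  calc |∑ u : BIdx P K, tail P K W u|
      ≤ ∑ u : BIdx P K, |tail P K W u| := Finset.abs_sum_le_sum_abs _ _
    _ = ∑ x : P.motif, ∑ k : Fin 3 → Fin K, |tail P K W (x, k)| := Fintype.sum_prod_type _
    _ ≤ ∑ x : P.motif, ∑ k : Fin 3 → Fin K,
          (if IsDeep K (depth P ρ) k then 0 else siteSum P (fun r => |W r|) x) := by
        refine Finset.sum_le_sum fun x _ => Finset.sum_le_sum fun k _ => ?_
        split_ifs with hk
        · rw [tail_eq_zero_of_deep P hW (u := (x, k)) hk, abs_zero]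
        · exact abs_tail_le P hW (x, k)
    _ = ∑ x : P.motif, ((Finset.univ.filter fun k : Fin 3 → Fin K => ¬ IsDeep K (depth P ρ) k).card
          : ℝ) * siteSum P (fun r => |W r|) x := by
        refine Finset.sum_congr rfl fun x _ => ?_
        rw [Finset.sum_ite, Finset.sum_const_zero, zero_add, Finset.sum_const, nsmul_eq_mul]
    _ ≤ ∑ x : P.motif, (6 * depth P ρ * (K : ℝ) ^ 2) * siteSum P (fun r => |W r|) x := by
        refine Finset.sum_le_sum fun x _ => mul_le_mul_of_nonneg_right ?_ (hsite0 x)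
        exact_mod_cast card_not_deep_le K (depth P ρ)
    _ = 6 * depth P ρ * (K : ℝ) ^ 2 * ∑ x ∈ P.motif, siteSum P (fun r => |W r|) x := by
        rw [← Finset.mul_sum, Finset.sum_coe_sort P.motif (siteSum P fun r => |W r|)]

/-- **The energy per particle of a finite-range potential is the limit of block energies**:
`|2E_W(block_K) − 2N_K e_W(P)| ≤ C·K²`. [folklore] -/
theorem abs_two_mul_energy_block_sub_le (hW : ∀ r, ρ ≤ r → W r = 0) (K : ℕ) :
    |2 * interactionEnergy W (blockConfig P K) -
        (K : ℝ) ^ 3 * (2 * P.motif.card * P.energyPerParticle W)| ≤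
      6 * depth P ρ * (K : ℝ) ^ 2 * ∑ x ∈ P.motif, siteSum P (fun r => |W r|) x := by
  rw [two_mul_energy_block_eq_sub_tails P hW K, sub_sub_cancel_left, abs_neg]
  exact abs_sum_tail_le P hW K

end FiniteRange

/-- Archimedean helper: `a·K³ ≤ b·K²` for all large `K` forces `a ≤ 0`. [folklore] -/
theorem nonpos_of_cubic_le_sq {a b : ℝ} (h : ∃ K₀ : ℕ, ∀ K : ℕ, K₀ ≤ K →
    a * (K : ℝ) ^ 3 ≤ b * (K : ℝ) ^ 2) : a ≤ 0 := by
  by_contra ha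
  push Not at ha
  obtain ⟨K₀, hK⟩ := h
  obtain ⟨n, hn⟩ := exists_nat_gt (b / a)
  set K : ℕ := max K₀ (n + 1) with hKdef
  have h1 := hK K (le_max_left _ _)
  have hKn : (n : ℝ) + 1 ≤ K := by
    have : n + 1 ≤ K := le_max_right _ _
    exact_mod_cast this
  have hKpos : (0 : ℝ) < K := by linarith [(Nat.cast_nonneg n : (0 : ℝ) ≤ n)]
  have h2 : a * K ≤ b := by
    have hK2 : (0 : ℝ) < (K : ℝ) ^ 2 := by positivity
    have : a * (K : ℝ) ^ 3 = (a * K) * (K : ℝ) ^ 2 := by ring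
    rw [this] at h1
    exact le_of_mul_le_mul_right h1 hK2
  have h3 : b / a < K := by linarith
  rw [div_lt_iff₀ ha] at h3
  linarith [mul_comm a (K : ℝ)]

/-- **Weak duality for the finite-range cone**: a stability constant of a finite-range potential never
exceeds its energy per particle on ANY periodic configuration — if `κ·N ≤ E_W(x)` for all injective `x`
and `W = 0` on `[ρ,∞)`, then `κ ≤ e_Q(W)` (test on the `K`-blocks of `Q`; block identity). [folklore] -/
theorem const_le_energyPerParticle_of_stable (Q : PeriodicConfiguration 3) {W : ℝ → ℝ} {ρ κ : ℝ}
    (hW : ∀ r, ρ ≤ r → W r = 0)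
    (hst : ∀ (N : ℕ) (x : Fin N → E3), Function.Injective x → κ * N ≤ interactionEnergy W x) :
    κ ≤ Q.energyPerParticle W := by
  set F : ℝ := (Q.motif.card : ℝ) with hFdef
  have hF : 0 < F := by rw [hFdef]; exact_mod_cast Q.motif_nonempty.card_pos
  set C : ℝ := 6 * depth Q ρ * ∑ x ∈ Q.motif, siteSum Q (fun r => |W r|) x with hCdef
  have hblock : ∀ K : ℕ, |2 * interactionEnergy W (blockConfig Q K) -
      (K : ℝ) ^ 3 * (2 * F * Q.energyPerParticle W)| ≤ C * (K : ℝ) ^ 2 := by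
    intro K
    have := abs_two_mul_energy_block_sub_le Q hW K
    rw [hCdef]
    calc _ ≤ 6 * depth Q ρ * (K : ℝ) ^ 2 * ∑ x ∈ Q.motif, siteSum Q (fun r => |W r|) x := this
      _ = _ := by ring
  have hcard : ∀ K : ℕ, ((Fintype.card (BIdx Q K) : ℕ) : ℝ) = F * (K : ℝ) ^ 3 := fun K => by
    rw [card_BIdx]; push_cast; rw [hFdef]
  have : 2 * F * (κ - Q.energyPerParticle W) ≤ 0 := by
    refine nonpos_of_cubic_le_sq (b := C) ⟨0, fun K _ => ?_⟩
    have h1 := hst _ _ (blockConfig_injective Q K)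
    rw [hcard] at h1
    have h2 := (abs_le.1 (hblock K)).2
    nlinarith [h1, h2]
  nlinarith

/-- **COMPLEMENTARY SLACKNESS FOR THE FINITE-RANGE CONE: `e_g(P) = −c`** — the witness
configuration is an exact per-particle ground state of the finite-range part `g` (block identity
for finite-range potentials + `g`-slack + stability). [folklore] -/
theorem energyPerParticle_g_eq {P : PeriodicConfiguration 3} {ρ c : ℝ} {g U f : ℝ → ℝ}
    (h : IsSplit ρ c g U f) (hv : c + f 0 / 2 ≤ -(P.energyPerParticle lennardJones)) :
    P.energyPerParticle g = -c := by
  set F : ℝ := (P.motif.card : ℝ) with hFdef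
  have hF : 0 < F := by rw [hFdef]; exact_mod_cast P.motif_nonempty.card_pos
  set C : ℝ := 6 * depth P ρ * ∑ x ∈ P.motif, siteSum P (fun r => |g r|) x with hCdef
  have hblock : ∀ K : ℕ, |2 * interactionEnergy g (blockConfig P K) -
      (K : ℝ) ^ 3 * (2 * F * P.energyPerParticle g)| ≤ C * (K : ℝ) ^ 2 := by
    intro K
    have := abs_two_mul_energy_block_sub_le P h.g_zero K
    rw [hCdef]
    calc _ ≤ 6 * depth P ρ * (K : ℝ) ^ 2 * ∑ x ∈ P.motif, siteSum P (fun r => |g r|) x := this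
      _ = _ := by ring
  have hcard : ∀ K : ℕ, ((Fintype.card (BIdx P K) : ℕ) : ℝ) = F * (K : ℝ) ^ 3 := fun K => by
    rw [card_BIdx]; push_cast; rw [hFdef]
  refine le_antisymm ?_ ?_
  · -- upper bound from the `g`-slack
    have key : ∀ ε : ℝ, 0 < ε → P.energyPerParticle g + c - ε ≤ 0 := by
      intro ε hε
      obtain ⟨K₀, -, hK⟩ := g_slack_le h hv hε
      have : 2 * F * (P.energyPerParticle g + c - ε) ≤ 0 := by
        refine nonpos_of_cubic_le_sq (b := C) ⟨K₀, fun K hKK => ?_⟩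
        have h1 := hK K hKK
        rw [hcard] at h1
        have h2 := (abs_le.1 (hblock K)).1
        nlinarith [h1, h2]
      nlinarith
    have : P.energyPerParticle g + c ≤ 0 := le_of_forall_pos_le_add fun ε hε => by
      have := key ε hε; linarith
    linarith
  · -- lower bound from stability
    have : -(2 * F * (P.energyPerParticle g + c)) ≤ 0 := by
      refine nonpos_of_cubic_le_sq (b := C) ⟨0, fun K _ => ?_⟩
      have h1 := h.stable _ _ (blockConfig_injective P K)
      rw [hcard] at h1
      have h2 := (abs_le.1 (hblock K)).2
      nlinarith [h1, h2]
    nlinarith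

/-- For a witness the slack `U` vanishes along every site function of `P`. [folklore] -/
theorem U_site_eq_zero {P : PeriodicConfiguration 3} {ρ c : ℝ} {g U f : ℝ → ℝ}
    (h : IsSplit ρ c g U f) (hv : c + f 0 / 2 ≤ -(P.energyPerParticle lennardJones))
    {x : E3} (hx : x ∈ P.points) (q : {q : E3 // q ∈ P.points ∧ q ≠ x}) :
    U (dist x q.1) = 0 :=
  U_eq_zero_of_mem_points h hv hx q.2.1 (fun heq => q.2.2 heq.symm)

/-- Hence **`e_U(P) = 0`**. [folklore] -/
theorem energyPerParticle_U_eq_zero {P : PeriodicConfiguration 3} {ρ c : ℝ} {g U f : ℝ → ℝ}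
    (h : IsSplit ρ c g U f) (hv : c + f 0 / 2 ≤ -(P.energyPerParticle lennardJones)) :
    P.energyPerParticle U = 0 := by
  unfold PeriodicConfiguration.energyPerParticle
  have : ∀ x ∈ P.motif, ∑' q : {q : E3 // q ∈ P.points ∧ q ≠ x}, U (dist x q.1) = 0 := by
    intro x hx
    have h0 : ∀ q : {q : E3 // q ∈ P.points ∧ q ≠ x}, U (dist x q.1) = 0 := fun q =>
      U_site_eq_zero h hv (P.mem_points_of_mem_motif hx) q
    simp only [h0, tsum_zero]
  rw [Finset.sum_congr rfl this]
  simp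

/-- For a witness the site functions of `f` on `P` are summable: termwise `f = V_LJ − g − U` with
`U = 0` on the distances of `P`. [folklore] -/
theorem summable_f_site {P : PeriodicConfiguration 3} {ρ c : ℝ} {g U f : ℝ → ℝ}
    (h : IsSplit ρ c g U f) (hv : c + f 0 / 2 ≤ -(P.energyPerParticle lennardJones))
    {x : E3} (hx : x ∈ P.points) :
    Summable fun q : {q : E3 // q ∈ P.points ∧ q ≠ x} => f (dist x q.1) := by
  have hV := P.summable_lennardJones_dist_three x
  have hg := summable_of_finRange P h.g_zero x
  refine (hV.sub hg).congr fun q => ?_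
  have hd : 0 < dist x q.1 := dist_pos.2 (fun heq => q.2.2 heq.symm)
  have h1 := h.split _ hd
  have h2 := U_site_eq_zero h hv hx q
  show lennardJones (dist x q.1) - g (dist x q.1) = f (dist x q.1)
  linarith

/-- **The periodic energy splits along the three cones**: `e(P) = e_g(P) + e_U(P) + e_f(P)`.
[folklore] -/
theorem energyPerParticle_split {P : PeriodicConfiguration 3} {ρ c : ℝ} {g U f : ℝ → ℝ}
    (h : IsSplit ρ c g U f) (hv : c + f 0 / 2 ≤ -(P.energyPerParticle lennardJones)) :
    P.energyPerParticle lennardJones =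
      P.energyPerParticle g + P.energyPerParticle U + P.energyPerParticle f := by
  unfold PeriodicConfiguration.energyPerParticle
  rw [← mul_add, ← mul_add, ← Finset.sum_add_distrib, ← Finset.sum_add_distrib]
  congr 1
  refine Finset.sum_congr rfl fun x hx => ?_
  have hxP := P.mem_points_of_mem_motif hx
  have hg := summable_of_finRange P h.g_zero x
  have hU : Summable fun q : {q : E3 // q ∈ P.points ∧ q ≠ x} => U (dist x q.1) := by
    refine (summable_zero).congr fun q => ?_
    exact (U_site_eq_zero h hv hxP q).symm
  have hf := summable_f_site h hv hxP
  rw [← hg.tsum_add hU, ← (hg.add hU).tsum_add hf]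
  refine tsum_congr fun q => ?_
  exact h.split _ (dist_pos.2 (fun heq => q.2.2 heq.symm))

/-- **COMPLEMENTARY SLACKNESS FOR THE BOCHNER CONE: `f 0 + 2e_f(P) = 0`** — the `P`-sum of `f`
INCLUDING the self-term vanishes. [folklore] -/
theorem f_zero_add_two_mul_energyPerParticle_f {P : PeriodicConfiguration 3} {ρ c : ℝ}
    {g U f : ℝ → ℝ} (h : IsSplit ρ c g U f)
    (hv : c + f 0 / 2 ≤ -(P.energyPerParticle lennardJones)) :
    f 0 + 2 * P.energyPerParticle f = 0 := by
  have h1 := energyPerParticle_split h hv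
  have h2 := energyPerParticle_g_eq h hv
  have h3 := energyPerParticle_U_eq_zero h hv
  have h4 := (witness_eq h hv).1
  have h5 := (witness_eq h hv).2
  rw [h2, h3] at h1
  linarith

/-- **Registered stub `stub_coneEnergies` of the line `closure-makes-nogap-exact`** (signature
verbatim): the periodic energies of the three cones of a witness. [folklore] -/
theorem stub_coneEnergies : ∀ (P : PeriodicConfiguration 3) (ρ c : ℝ) (g U f : ℝ → ℝ),
    IsSplit ρ c g U f → c + f 0 / 2 ≤ -(P.energyPerParticle lennardJones) →
    P.energyPerParticle g = -c ∧ P.energyPerParticle U = 0 ∧ f 0 + 2 * P.energyPerParticle f = 0 :=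
  fun _ _ _ _ _ _ h hv =>
    ⟨energyPerParticle_g_eq h hv, energyPerParticle_U_eq_zero h hv,
      f_zero_add_two_mul_energyPerParticle_f h hv⟩

end Summit.AtomisticToContinuum.Crystallization.Theorems.ThreeConeCertificateExactCertificate.Slackness

end
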